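import Summits.BirchSwinnertonDyer.Rank1Residual.Additive.QuadraticBranchOddStrictSelmer
import Literature.NumberTheory.EllipticCurves.CanonicalPAdicHeightThetaProofs
import Literature.NumberTheory.EllipticCurves.BSDRootNumberSmallConductorProofs
import HarnessLib

/-!
# EVIDENCE ITEM (typed `@[conjecture]`, NOTHING asserted): the pre-registered law **P2♭** — the
# leading coefficient of Kobayashi's minus function on the quadratic branch of the good supersingular
# twin `V` of an additive rank-one curve `W = V ⊗ χ_{p*}` has valuation
# `2ν(W, p) + ord_p(#Ш_an(W)·Tam(W)·c_∞/#W(ℚ)_tors²) − 1` IN THE ENGINE'S COORDINATES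
# (cell `b2b-bsdres`, CLASS-CLOSURE lane, seat cc-typer-6 GEN 8 = pen / second scorer of the held-out
# test `E1-S2SHARP`; class served by the data: O7-ss ∩ `e = 2` (NON-CM, r_an = 1) and, fitted post hoc,
# O10-PS (CM); offered to cc-typer-2 / n1011 (O7-ss) and x1b (O10) for a reading — their call)

HONEST FRAMING (cell `b2b-bsdres`, run/shared/lean/b2b/bsd-rank1-residual/, verbatim in every
file): the goal of the cell is to DELETE the COMBINATION-SHAPED residual classes of the
Birch–Swinnerton-Dyer formula for ALL analytic-rank `≤ 1` elliptic curves over `ℚ` — "full BSD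
formula for every rank `≤ 1` curve in class `C`" assembled STRICTLY from published theorems — so
that the rank-`≤ 1` remainder becomes exactly the CONSTRUCTION-SHAPED classes, which are TYPED
(missing-input `Prop`s), NOT attempted. This is not "finishing BSD". CLASS-CLOSURE lane: prove
what is provable now; shrink each hard class to its core with data; no claim beyond stated classes;
research routes; census / instrument output = EVIDENCE / conjecture items, NEVER a Literature fact;
`RESIDUAL-MAP.md` marks change only by signed lines. THIS FILE: ONE `@[conjecture] def` (an
obligation node recording an EMPIRICAL LAW with its evidence label; not a theorem in print, not a
named Literature fact, net debt `0`, no `sorry`); O7-ss and O10 stay OPEN / CONSTRUCTION-SHAPED;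
nothing is booked; no label moves; the law claims nothing about `BSD(W, p)` of any pair.

## The law, as registered and read (labels VERBATIM from the record)

Objects: `(W, p)` with `p ≥ 5`, `W/ℚ` of analytic rank `1` with ADDITIVE potentially-good reduction
of index `e = 2` at `p` (tree predicate `Additive.SubGss`: the twin `V` = minimal model of
`W ⊗ χ_{p*}`, `p* = (−1)^{(p−1)/2} p`, is GOOD SUPERSINGULAR at `p`, `a_p(V) = 0`). ENGINE (single;
x1b `code/b2b-bsdres-x1b/gen25/etaL.gp` / `etaL_py.py` dd87fdd86e510919, PARI 2.17.2 `msfromell(V)`,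
`mspadicinit`, `mspadicmoments`, `mspadicseries(μ, i)`, `i = (p−1)/2`): `C1, C2` = the two
coordinates, in the basis `(ω, φω)` of `D_cris(V)`, of the `η = ω^{(p−1)/2}`-branch `p`-adic
`L`-series of `V`; `a₁(C1)` = its `T¹` coefficient (`T` the cyclotomic variable, `γ = 1 + p`).
`ν(W, p) = max{n : 12P ∈ W_n(ℚ_p)}` for a generator `P` of `W(ℚ)/tors` (x1b `gen24/locdiv.py`,
exact arithmetic; = the `p`-divisibility level of `P` in `W(ℚ_p)` off the two Kosters–Pannekoek
exceptional congruences, where `W₀(ℚ_p) ≅ ℤ_p` and `W_n = pⁿW₀`; exceptional rows EXCLUDED by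
predicate). LAWS (pre-registered before any held-out value, `class-closure/O10/E1-S2SHARP-PREREG-
DRAFT-typer6.md`, registered body 2d27be21 / current 3fcf40dc0ef965da, registration requests.jsonl
`x1b-g27-S2SHARP-HA-REGISTRATION-…` 2026-08-21T11:03:01Z): **S2♯** `v_p(a₁ C1) = 2ν + ord_p #Ш_an − 1`
(the claim under test) and the competing **P2♭** (x1b, engine owner)
`v_p(a₁ C1) = 2ν + ord_p(#Ш_an(W)·Tam(W)·c_∞(W)/#W(ℚ)_tors²) − 1` (S2♯ with `W`'s full BSD
constant; PARI's symbol is normalised by `Ω⁺ = ω₁`, whence `c_∞`). READING RULE fixed at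
registration: S2♯ FAIL exactly on the `p ∣ Tam` rows + P2♭ 100 % ⇒ 'S2♯ REFUTED in favour of P2♭'.

RESULT OF RECORD (x1b GEN 27 report `class-closure/O10/E1-S2SHARP-2026-08-21.md` 79d758c797a260bd;
scorer of record `code/b2b-bsdres-cc-typer-6/gen6-s2sharp/s2sharp_score.py` v2 14e7a290ca4b679a;
census-lead GEN 12 READ requests l.1795 — scorer re-run BYTE-IDENTICAL, hash thirds recomputed; pen's
second score `class-closure/O10/E1-S2SHARP-SCORE2-typer6.md` 4789e6299510a8af BYTE-IDENTICAL ×3):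
POPULATION H-a = all `(class, p)` cells of the lane universes with `Additive.SubGss`, `p ≥ 5`, every
member curve, `N_W` in Cremona's range, exclusions / deferrals BY PREDICATE as registered (1 446
excluded, 2 322 deferred, 455 pass-2 K0 rows UNRUN → addendum A3), hash thirds
(`sha256("label|p") mod 3 = 0` = open tuning third; the rest SEALED, scored ONCE; kit jobs
j132190–j132200 + helpers j132858 / j132859 / j133590): **P1** (order pattern `(ord C1, ord C2) =
(1, 1)` on r = 1 rows) PASS 25/25 sealed (+14/14 tuning); **P2 = S2♯ FAIL 7/25** — the 18 failures
are EXACTLY the sealed rows with `p ∣ Tam(W)`; **P2♭ PASS 39/39 (25 sealed + 14 tuning)**,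
discriminating `p ∣ Tam` rows 18/18 sealed (+8/8 tuning) as `(¬S2♯, P2♭)`, cross-tab others 0 ⇒
**'S2♯ refuted 18/18 on p∣Tam' in favour of P2♭ (pre-registered)**; **P3** (r = 0 K0 slope
`v_p(C2(0)) = ord_p(L(W,1)/Ω_W) − 1`) PASS 787/787 sealed (+427/427; `p = 3` annex 228 + 116);
wrong-law controls `ν − 1` / `2ν − 1` / `2ν` fail on 19 / 18 / 18 sealed rows; permutation control
uninformative (all permuted `ν = 0`), disclosed. FITTED POST HOC before registration: 274/274 O10-PS
(CM) rows satisfy S2 `= 2ν − 1` (x1b GEN 25 `class-closure/O10/E1-ETA-BRANCH.md`, second-scored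
`E1-ETA-SCORE2-typer6.md`) — there `p ∤ Tam·#tors` and `ord_p #Ш_an = 0`, so S2 = S2♯ = P2♭.
LABEL OF RECORD (census-lead GEN 12, verbatim): EVIDENCE / DIAGNOSTIC; claims nothing about
`BSD_p`; **'39/39 (25 sealed + 14 tuning)'**; **'Ш-term untested'** (0 rows with
`ord_p #Ш_an ≥ 1`); **'#tors / c_∞ factors unexercised'** (no decided row has `p ∣ #W(ℚ)_tors`;
`c_∞ ∈ {1, 2}` is invisible at odd `p`); **'single-engine'** (rank-1 rows PARI OMS only; `ν`
two-engine 39/39); `ν = 1` on 3/39; **'S2♯ refuted 18/18 on p∣Tam'**; nothing booked; no mark.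

## DICTIONARY FLAG (why the statement carries an offset `δ`)

The tree has no PARI: below, `a₁(C1)` is TRANSCRIBED as `coeff₁ L` for `L` any function with
`IsQuadraticBranchMinusLFunction f p ϖ L` — Kobayashi's `L_p⁻(V, η, X)` on the quadratic branch,
pinned by the interpolation (3.5) and `L(0) = 0` (3.7) UP TO A UNIT of `ℤ_p` (so
`v_p(coeff₁ L)` is pinned: `coeff₀ = 0`). PRINT gives `C1 ∝ L_p⁻(V, η, ·)·log⁺` qualitatively
(Kobayashi p. 7: `L_p(E, α, η, X) = L⁻_η log⁺ + α L⁺_η log⁻`, signs opposite to Pollack's), but the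
`p`-power relating PARI's `ω`-coordinate `a₁(C1)` to `coeff₁ L` — Pollack's `log⁺(0) = p⁻¹`, the
`(1 − p⁻¹φ)⁻²` / `φ`-matrix entries of PARI's `D_cris` normalisation, `Ω^δ_f·ϖ` versus `ω₁` — is
NOT kernel-checked and NOT settled in print at `p² ∣ N_W` (Delbourgo 1998 p. 30: nothing in print
for additive `p`); the good-prime calibration (PREREG §4 STEP-0: Kurihara–Pollack 2007 (2.5) in
PARI coordinates, 20/20, `b2b-bsdres-x1b/gen27/s0kp/S0-KP25-REPORT.md`) reads, at GOOD `p`,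
`v(a₁-combination) = 2ν + v(C_p) − 1` with the same `−1`. Hence the law is typed with an explicit
integer OFFSET `δ`: the ENGINE READING OF RECORD is `δ = −1` for `a₁(C1)`; the value of `δ` for
the tree's `coeff₁ L` is the engine's `−1` plus the valuation of that normalising constant — an
OPEN DICTIONARY ENTRY (x1b's `??mspadicmoments` check, PREREG v1.1 NOTE), to be closed by a
computation note, never by assertion. Consumers instantiate `δ`; the evidence label above attaches
to the engine reading only. `ν` is transcribed as the `p`-divisibility level `n` of the image of
`P` in `W(ℚ_p)` (`WeierstrassCurve.toPadicPoint`) under the hypothesis "`W(ℚ_p)` has no point of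
order `p`" (= off the Kosters–Pannekoek exceptional rows, where `W(ℚ_p) = W₀(ℚ_p) × (prime-to-p)`
with `W₀(ℚ_p) ≅ ℤ_p`, so `12P ∈ W_n ⇔ P ∈ pⁿW(ℚ_p)`); `#Ш_an(W)` as the tree's `shaAn W` (Miller's
`#Ш_an`, BSD period `Ω_W` with `c_∞` inside, for `W` globally minimal) read as a rational `q`;
`c_∞` dropped (`p` odd). PREREG countersign A6 foresaw the name `X12.O10.EtaBranchLogSquare-
ValuationAt`; the law's population is the ADDITIVE non-CM one, hence this file and name.

References (locators only; the interpolation and (3.7) are cited on `IsQuadraticBranchMinusLFunction`):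
[Kobayashi2003] §3 (3.5)–(3.7) p. 7, §4 p. 8; [KuriharaPollack2007] §2.6 (2.5) (corpus
`book:burns2007-l-functions-galois-representations` p0368–p0369); [KostersPannekoek2017] Cor. 2;
[Miller2011LMS] §1; [Delbourgo1998Compositio] p. 30.
-/

noncomputable section

open scoped Classical MatrixGroups ModularForm

open CongruenceSubgroup WeierstrassCurve Literature.NumberTheory.EllipticCurves
  Literature.NumberTheory.EllipticCurves.ModularForms
  Literature.NumberTheory.EllipticCurves.Kobayashi2003

namespace Summit.BirchSwinnertonDyer.Rank1Residual.Additive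

/-- **EVIDENCE ITEM — the pre-registered law P2♭ with dictionary offset `δ` (typed `@[conjecture]`;
an EMPIRICAL LAW, not a theorem in print; NOTHING asserted).** For `W/ℚ` (globally minimal,
`r_an(W) = 1`), a prime `p ≥ 5`, the good supersingular twin `V` (`C • W^{(p*)} = V`, `V` good at
`p`, `a_p(V) = 0`, newform `f`, period ratio `ϖ` of parity `η(−1)`), every `L` with
`IsQuadraticBranchMinusLFunction f p ϖ L` (Kobayashi's `L_p⁻(V, η, X)`, `η = ω^{(p−1)/2}`, up to a
unit; `L(0) = 0`), `W(ℚ_p)` without points of order `p` (off the Kosters–Pannekoek exceptional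
rows), `P ∈ W(ℚ)` of infinite order generating `W(ℚ)` modulo torsion whose image in `W(ℚ_p)` is
divisible by `pⁿ` and not by `pⁿ⁺¹` (`n = ν(W, p)`), and `#Ш_an(W) = q ∈ ℚ`:
`coeff₁ L ≠ 0` and `v_p(coeff₁ L) = 2n + ord_p(q · Tam(W) / #W(ℚ)_tors²) + δ`.
ENGINE READING OF RECORD: `δ = −1` for PARI's `a₁(C1)` — EVIDENCE / DIAGNOSTIC, held out and
pre-registered: P2♭ 39/39 (25 sealed + 14 tuning) on population H-a (`Additive.SubGss`, `p ≥ 5`,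
r_an = 1, every member curve, Cremona range, exclusions by predicate), S2♯ (the `Tam`-free law)
refuted 18/18 on `p ∣ Tam`; fitted post hoc 274/274 on O10-PS (CM); Ш-term untested; `#tors` /
`c_∞` factors unexercised; single-engine (PARI OMS); `ν` two-engine 39/39; report 79d758c797a260bd,
scorer 14e7a290ca4b679a, census read requests l.1795. The `δ` of the tree's `coeff₁ L` differs from
the engine's `−1` by the valuation of PARI's normalising constant (module docstring, DICTIONARY
FLAG) — OPEN, not asserted. Claims nothing about `BSD(W, p)`; nothing booked; no label moves.
[cite: Kobayashi2003, §3 (3.5)–(3.7) (p. 7) and §4 (p. 8)]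
[cite: KuriharaPollack2007, §2.6 (2.5)] [cite: Miller2011LMS, §1 (arXiv:1010.2431 p. 3)] -/
@[conjecture] def QuadraticBranchMinusLeadingValuationAt (W : WeierstrassCurve ℚ) [W.IsElliptic]
    [W.IsGloballyMinimal] (p : ℕ) [Fact p.Prime] (δ : ℤ) : Prop :=
  ∀ (V : WeierstrassCurve ℚ) [V.IsElliptic] [V.IsGloballyMinimal] (C : VariableChange ℚ)
    {N : ℕ} [NeZero N] {f : CuspForm (Gamma0 N) 2},
    5 ≤ p → C • W.quadraticTwist ((-1) ^ (p / 2) * p) = V →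
    V.HasGoodReductionAtPrime p → V.frobeniusTrace p = 0 → W.analyticRank = 1 →
    IsNewformOf V f →
    ∀ (ϖ : ℚ), (if Even (p / 2) then (ϖ : ℝ) * V.realPeriodRat = plusPeriod f
        else (ϖ : ℝ) * V.imaginaryPeriodRat = minusPeriod f) →
    ∀ (L : IwasawaAlgebra p), IsQuadraticBranchMinusLFunction f p ϖ L →
    (∀ Q : (W.baseChange ℚ_[p]).toAffine.Point, p • Q = 0 → Q = 0) →
    ∀ (P : W.toAffine.Point) (n : ℕ), ¬ IsOfFinAddOrder P →
    (∀ R : W.toAffine.Point, ∃ (k : ℤ) (T : W.toAffine.Point), IsOfFinAddOrder T ∧ R = k • P + T) →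
    (∃ Q : (W.baseChange ℚ_[p]).toAffine.Point, p ^ n • Q = W.toPadicPoint p P) →
    (∀ Q : (W.baseChange ℚ_[p]).toAffine.Point, p ^ (n + 1) • Q ≠ W.toPadicPoint p P) →
    ∀ (q : ℚ), shaAn W = (q : ℂ) →
    PowerSeries.coeff 1 L ≠ 0 ∧
      ((PowerSeries.coeff 1 L : ℤ_[p]) : ℚ_[p]).valuation =
        2 * (n : ℤ) + padicValRat p (q * W.tamagawaProduct / (W.torsionOrder : ℚ) ^ 2) + δ

/-- Unfolding (by definition). -/
theorem quadraticBranchMinusLeadingValuationAt_iff (W : WeierstrassCurve ℚ) [W.IsElliptic]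
    [W.IsGloballyMinimal] (p : ℕ) [Fact p.Prime] (δ : ℤ) :
    QuadraticBranchMinusLeadingValuationAt W p δ ↔
      ∀ (V : WeierstrassCurve ℚ) [V.IsElliptic] [V.IsGloballyMinimal] (C : VariableChange ℚ)
        {N : ℕ} [NeZero N] {f : CuspForm (Gamma0 N) 2},
        5 ≤ p → C • W.quadraticTwist ((-1) ^ (p / 2) * p) = V →
        V.HasGoodReductionAtPrime p → V.frobeniusTrace p = 0 → W.analyticRank = 1 →
        IsNewformOf V f →
        ∀ (ϖ : ℚ), (if Even (p / 2) then (ϖ : ℝ) * V.realPeriodRat = plusPeriod f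
            else (ϖ : ℝ) * V.imaginaryPeriodRat = minusPeriod f) →
        ∀ (L : IwasawaAlgebra p), IsQuadraticBranchMinusLFunction f p ϖ L →
        (∀ Q : (W.baseChange ℚ_[p]).toAffine.Point, p • Q = 0 → Q = 0) →
        ∀ (P : W.toAffine.Point) (n : ℕ), ¬ IsOfFinAddOrder P →
        (∀ R : W.toAffine.Point, ∃ (k : ℤ) (T : W.toAffine.Point),
          IsOfFinAddOrder T ∧ R = k • P + T) →
        (∃ Q : (W.baseChange ℚ_[p]).toAffine.Point, p ^ n • Q = W.toPadicPoint p P) →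
        (∀ Q : (W.baseChange ℚ_[p]).toAffine.Point, p ^ (n + 1) • Q ≠ W.toPadicPoint p P) →
        ∀ (q : ℚ), shaAn W = (q : ℂ) →
        PowerSeries.coeff 1 L ≠ 0 ∧
          ((PowerSeries.coeff 1 L : ℤ_[p]) : ℚ_[p]).valuation =
            2 * (n : ℤ) + padicValRat p (q * W.tamagawaProduct / (W.torsionOrder : ℚ) ^ 2) + δ :=
  Iff.rfl

/-- The offset is a bookkeeping parameter: the law at `δ` and at `δ'` cannot both hold for a pair
that has a witness (all the data `V, C, f, ϖ, L, P, n, q`) unless `δ = δ'` — recorded so that a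
consumer instantiating `δ` knows the instantiation is a genuine choice. PROVED (arithmetic). -/
theorem QuadraticBranchMinusLeadingValuationAt.offset_unique {W : WeierstrassCurve ℚ} [W.IsElliptic]
    [W.IsGloballyMinimal] {p : ℕ} [Fact p.Prime] {δ δ' : ℤ}
    (h : QuadraticBranchMinusLeadingValuationAt W p δ)
    (h' : QuadraticBranchMinusLeadingValuationAt W p δ')
    (V : WeierstrassCurve ℚ) [V.IsElliptic] [V.IsGloballyMinimal] (C : VariableChange ℚ)
    {N : ℕ} [NeZero N] {f : CuspForm (Gamma0 N) 2} (hp : 5 ≤ p)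
    (hV : C • W.quadraticTwist ((-1) ^ (p / 2) * p) = V) (hgood : V.HasGoodReductionAtPrime p)
    (hap : V.frobeniusTrace p = 0) (hr : W.analyticRank = 1) (hf : IsNewformOf V f) (ϖ : ℚ)
    (hϖ : if Even (p / 2) then (ϖ : ℝ) * V.realPeriodRat = plusPeriod f
      else (ϖ : ℝ) * V.imaginaryPeriodRat = minusPeriod f)
    (L : IwasawaAlgebra p) (hL : IsQuadraticBranchMinusLFunction f p ϖ L)
    (htors : ∀ Q : (W.baseChange ℚ_[p]).toAffine.Point, p • Q = 0 → Q = 0)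
    (P : W.toAffine.Point) (n : ℕ) (hP : ¬ IsOfFinAddOrder P)
    (hgen : ∀ R : W.toAffine.Point, ∃ (k : ℤ) (T : W.toAffine.Point),
      IsOfFinAddOrder T ∧ R = k • P + T)
    (hdiv : ∃ Q : (W.baseChange ℚ_[p]).toAffine.Point, p ^ n • Q = W.toPadicPoint p P)
    (hndiv : ∀ Q : (W.baseChange ℚ_[p]).toAffine.Point, p ^ (n + 1) • Q ≠ W.toPadicPoint p P)
    (q : ℚ) (hq : shaAn W = (q : ℂ)) : δ = δ' := by
  have e := (h V C hp hV hgood hap hr hf ϖ hϖ L hL htors P n hP hgen hdiv hndiv q hq).2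
  have e' := (h' V C hp hV hgood hap hr hf ϖ hϖ L hL htors P n hP hgen hdiv hndiv q hq).2
  omega

end Summit.BirchSwinnertonDyer.Rank1Residual.Additive

end
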